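import Summits.PneNP.PneNP.Theorems.KarlinRubinMonotoneSufficesRoomParams

/-!
# Crux `MonotoneSuffices` (stmt-PneNP-18026), the ROOM theorem — part 4c:
# the parameters of the guess-and-verify detector (size side and summary)

Continues part 4b (same notation `k, L, Q, t, θ`): the size bound
`C(n,t) (n(t+1) + 60(n+3)^4 + 1) ≤ n^{t+6} ≤ n^{(2δ+ε) log₂ n}` (`sizeSide`: `2^t ≤ 1602 n^{2δ} (L+1)²`, take
`log₂`, use `18 + 2 log₂(L+1) ≤ ε log₂ n`), and the summary `room_derived` / `room_params` of all derived
facts consumed by the final assembly (part 5). Elementary arithmetic only.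
-/

set_option linter.dupNamespace false -- `Summit.PneNP.PneNP.…`: summit = sub-problem name (D-0017 single-conjunct layout)

namespace Summit.PneNP.PneNP.Theorems.MonotoneSuffices.Room

open Real Finset

/-- **Size side.** `C(n,t) (n(t+1) + 60(n+3)^4 + 1) ≤ n^{t+6} ≤ n^{(2δ+ε) log₂ n}`. [folklore] -/
theorem sizeSide {δ ε : ℝ} {n k L Q t : ℕ} (ht2Q : 2 ^ t ≤ 2 * Q)
    (hQk : Q * k ^ 2 ≤ 800 * n * (L + 1) ^ 2 + k ^ 2) (hk2 : k ^ 2 ≤ 4 * n) (hn : 2048 ≤ n)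
    (hL11 : 11 ≤ L) (htk : t ≤ k) (h6k : 6 * k ≤ n)
    (hkSq : (n : ℝ) ^ (1 - 2 * δ) ≤ (k : ℝ) ^ 2)
    (hslack : 18 + 2 * Real.logb 2 ((L : ℝ) + 1) ≤ ε * Real.logb 2 n) :
    (((n.choose t * (n * (t + 1) + 60 * (n + 3) ^ 4 + 1)) : ℕ) : ℝ) ≤
      (n : ℝ) ^ ((2 * δ + ε) * Real.logb 2 n) := by
  -- the integer bound `≤ n^{t+6}`
  have hS : n.choose t * (n * (t + 1) + 60 * (n + 3) ^ 4 + 1) ≤ n ^ (t + 6) := by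
    have h1 : n.choose t ≤ n ^ t := Nat.choose_le_pow n t
    have hinner : n * (t + 1) + 60 * (n + 3) ^ 4 + 1 ≤ n ^ 6 := by
      have ha : n * (t + 1) ≤ n ^ 2 := by rw [sq]; exact Nat.mul_le_mul_left n (by omega)
      have hb : (n + 3) ^ 4 ≤ (2 * n) ^ 4 := Nat.pow_le_pow_left (by omega) 4
      have hc : 60 * (2 * n) ^ 4 ≤ n ^ 5 := by
        calc 60 * (2 * n) ^ 4 = 960 * n ^ 4 := by ring
          _ ≤ n * n ^ 4 := Nat.mul_le_mul_right _ (by omega)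
          _ = n ^ 5 := by ring
      have hd : n ^ 2 ≤ n ^ 5 := Nat.pow_le_pow_right (by omega) (by norm_num)
      have he : 1 ≤ n ^ 5 := Nat.one_le_pow _ _ (by omega)
      have hf : 3 * n ^ 5 ≤ n ^ 6 := by
        calc 3 * n ^ 5 ≤ n * n ^ 5 := Nat.mul_le_mul_right _ (by omega)
          _ = n ^ 6 := by ring
      have hb' : 60 * (n + 3) ^ 4 ≤ 60 * (2 * n) ^ 4 := Nat.mul_le_mul_left _ hb
      omega
    calc n.choose t * (n * (t + 1) + 60 * (n + 3) ^ 4 + 1) ≤ n ^ t * n ^ 6 := Nat.mul_le_mul h1 hinner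
      _ = n ^ (t + 6) := by rw [← pow_add]
  have hn0 : (0 : ℝ) < n := by exact_mod_cast (show 0 < n by omega)
  have hn1 : (1 : ℝ) ≤ n := by exact_mod_cast (show 1 ≤ n by omega)
  -- `2^t k² ≤ 1602 n (L+1)²`
  have h2tk : (2 : ℝ) ^ t * (k : ℝ) ^ 2 ≤ 1602 * n * ((L : ℝ) + 1) ^ 2 := by
    have h : 2 ^ t * k ^ 2 ≤ 1602 * n * (L + 1) ^ 2 := by
      have hL4 : 4 ≤ (L + 1) ^ 2 := by nlinarith
      have hA : 800 * n * (L + 1) ^ 2 + 4 * n ≤ 801 * n * (L + 1) ^ 2 := by nlinarith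
      calc 2 ^ t * k ^ 2 ≤ 2 * Q * k ^ 2 := Nat.mul_le_mul_right _ ht2Q
        _ = 2 * (Q * k ^ 2) := by ring
        _ ≤ 2 * (800 * n * (L + 1) ^ 2 + k ^ 2) := Nat.mul_le_mul_left _ hQk
        _ ≤ 2 * (800 * n * (L + 1) ^ 2 + 4 * n) := by omega
        _ ≤ 2 * (801 * n * (L + 1) ^ 2) := Nat.mul_le_mul_left _ hA
        _ = 1602 * n * (L + 1) ^ 2 := by ring
    have h' : ((2 ^ t * k ^ 2 : ℕ) : ℝ) ≤ ((1602 * n * (L + 1) ^ 2 : ℕ) : ℝ) := by exact_mod_cast h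
    push_cast at h'
    exact h'
  -- divide by `n^{1-2δ} ≤ k²`: `2^t ≤ 1602 n^{2δ} (L+1)²`
  have hpow0 : (0 : ℝ) < (n : ℝ) ^ (1 - 2 * δ) := Real.rpow_pos_of_pos hn0 _
  have h2t : (2 : ℝ) ^ t ≤ 1602 * (n : ℝ) ^ (2 * δ) * ((L : ℝ) + 1) ^ 2 := by
    have hsplit : (n : ℝ) ^ (2 * δ) * (n : ℝ) ^ (1 - 2 * δ) = n := by
      rw [← Real.rpow_add hn0]; norm_num
    have h1 : (2 : ℝ) ^ t * (n : ℝ) ^ (1 - 2 * δ) ≤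
        (1602 * (n : ℝ) ^ (2 * δ) * ((L : ℝ) + 1) ^ 2) * (n : ℝ) ^ (1 - 2 * δ) := by
      calc (2 : ℝ) ^ t * (n : ℝ) ^ (1 - 2 * δ) ≤ (2 : ℝ) ^ t * (k : ℝ) ^ 2 :=
            mul_le_mul_of_nonneg_left hkSq (by positivity)
        _ ≤ 1602 * n * ((L : ℝ) + 1) ^ 2 := h2tk
        _ = (1602 * (n : ℝ) ^ (2 * δ) * ((L : ℝ) + 1) ^ 2) * (n : ℝ) ^ (1 - 2 * δ) := by
            rw [show (1602 * (n : ℝ) ^ (2 * δ) * ((L : ℝ) + 1) ^ 2) * (n : ℝ) ^ (1 - 2 * δ) =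
              1602 * ((n : ℝ) ^ (2 * δ) * (n : ℝ) ^ (1 - 2 * δ)) * ((L : ℝ) + 1) ^ 2 by ring, hsplit]
    exact le_of_mul_le_mul_right h1 hpow0
  -- take `log₂`
  have hlog : (t : ℝ) ≤ Real.logb 2 1602 + 2 * δ * Real.logb 2 n + 2 * Real.logb 2 ((L : ℝ) + 1) := by
    have h1 : Real.logb 2 ((2 : ℝ) ^ t) ≤ Real.logb 2 (1602 * (n : ℝ) ^ (2 * δ) * ((L : ℝ) + 1) ^ 2) :=
      Real.logb_le_logb_of_le one_lt_two (by positivity) h2t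
    have h2 : Real.logb 2 ((2 : ℝ) ^ t) = t := by
      rw [Real.logb_pow, Real.logb_self_eq_one one_lt_two, mul_one]
    have h3 : Real.logb 2 (1602 * (n : ℝ) ^ (2 * δ) * ((L : ℝ) + 1) ^ 2) =
        Real.logb 2 1602 + 2 * δ * Real.logb 2 n + 2 * Real.logb 2 ((L : ℝ) + 1) := by
      rw [Real.logb_mul (by positivity) (by positivity), Real.logb_mul (by norm_num) (by positivity),
        Real.logb_rpow_eq_mul_logb_of_pos hn0, Real.logb_pow]
      push_cast
      ring
    linarith
  have h1602 : Real.logb 2 1602 < 11 := by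
    have h : Real.logb 2 1602 < Real.logb 2 2048 := Real.logb_lt_logb one_lt_two (by norm_num) (by norm_num)
    have h2048 : Real.logb 2 (2048 : ℝ) = 11 := by
      rw [show (2048 : ℝ) = 2 ^ (11 : ℕ) by norm_num, Real.logb_pow, Real.logb_self_eq_one one_lt_two]
      norm_num
    linarith
  have hexp : ((t + 6 : ℕ) : ℝ) ≤ (2 * δ + ε) * Real.logb 2 n := by
    push_cast
    linarith
  calc (((n.choose t * (n * (t + 1) + 60 * (n + 3) ^ 4 + 1)) : ℕ) : ℝ) ≤ ((n ^ (t + 6) : ℕ) : ℝ) := by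
        exact_mod_cast hS
    _ = (n : ℝ) ^ ((t + 6 : ℕ) : ℝ) := by rw [Nat.cast_pow, Real.rpow_natCast]
    _ ≤ (n : ℝ) ^ ((2 * δ + ε) * Real.logb 2 n) := Real.rpow_le_rpow_of_exponent_le hn1 hexp

/-- **The derived parameters.** See the module docstring. [folklore] -/
theorem room_derived {δ ε : ℝ} {n k L Q t θ : ℕ}
    (hL : L = Nat.log 2 n) (hQ : Q = 800 * n * (L + 1) ^ 2 / k ^ 2 + 1)
    (ht : t = Nat.log 2 Q + 1) (hθ : θ = (n - t) / 2 ^ t + k / 4 + 1)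
    (hn : 2048 ≤ n) (hkBig : 3200 * (L + 1) ^ 2 + 20 ≤ k) (h6k : 6 * k ≤ n) (hk2 : k ^ 2 ≤ 4 * n)
    (hkSq : (n : ℝ) ^ (1 - 2 * δ) ≤ (k : ℝ) ^ 2)
    (hslack : 18 + 2 * Real.logb 2 ((L : ℝ) + 1) ≤ ε * Real.logb 2 n) :
    (t ≤ k ∧ k ≤ n ∧ t ≤ n) ∧
    (0 < ((n - t : ℕ) : ℝ) * (2 : ℝ)⁻¹ ^ t ∧ ((n - t : ℕ) : ℝ) * (2 : ℝ)⁻¹ ^ t ≤ θ ∧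
      (θ : ℝ) ≤ 3 * (((n - t : ℕ) : ℝ) * (2 : ℝ)⁻¹ ^ t) ∧
      (n.choose t : ℝ) * Real.exp (-(((θ : ℝ) / (((n - t : ℕ) : ℝ) * (2 : ℝ)⁻¹ ^ t) - 1) ^ 2 *
        (((n - t : ℕ) : ℝ) * (2 : ℝ)⁻¹ ^ t)) / 4) ≤ Real.exp (-((L : ℝ) + 1))) ∧
    (0 < ((n - k : ℕ) : ℝ) * (2 : ℝ)⁻¹ ^ t ∧
      -(((n - k : ℕ) : ℝ) * (2 : ℝ)⁻¹ ^ t) ≤ (θ : ℝ) - ((k - t : ℕ) : ℝ) - 1 ∧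
      (θ : ℝ) - ((k - t : ℕ) : ℝ) - 1 ≤ ((n - k : ℕ) : ℝ) * (2 : ℝ)⁻¹ ^ t ∧
      Real.exp (-((1 - ((θ : ℝ) - ((k - t : ℕ) : ℝ) - 1) / (((n - k : ℕ) : ℝ) * (2 : ℝ)⁻¹ ^ t)) ^ 2 *
        (((n - k : ℕ) : ℝ) * (2 : ℝ)⁻¹ ^ t)) / 4) ≤ Real.exp (-((L : ℝ) + 1))) ∧
    (((n.choose t * (n * (t + 1) + 60 * (n + 3) ^ 4 + 1) : ℕ) : ℝ) ≤
      (n : ℝ) ^ ((2 * δ + ε) * Real.logb 2 n)) := by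
  obtain ⟨hQt, ht2Q, hQk, hQk', ht8, ht3L, h8t, hE3, -, hnL, hL11⟩ := natFacts hL hQ ht hn hkBig h6k hk2
  have hk20 : 20 ≤ k := le_trans (by omega) hkBig
  have htk : t ≤ k := by omega
  have hkn : k ≤ n := by omega
  exact ⟨⟨htk, hkn, htk.trans hkn⟩, nullSide hθ hQt hQk' ht3L hE3 hnL hL11 hk20 htk,
    plantedSide hθ hQt hQk' ht8 h8t hE3 hk20, sizeSide ht2Q hQk hk2 hn hL11 htk h6k hkSq hslack⟩

end Summit.PneNP.PneNP.Theorems.MonotoneSuffices.Room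

namespace Summit.PneNP.PneNP.Theorems.MonotoneSuffices.Room

/-- Registered sub-goal `room_params` of stmt-PneNP-18026 (room theorem, part 4b): the derived parameter
facts of the guess-and-verify detector, exported verbatim. [folklore] -/
theorem room_params :
    ∀ {δ ε : ℝ} {n k L Q t θ : ℕ}, L = Nat.log 2 n → Q = 800 * n * (L + 1) ^ 2 / k ^ 2 + 1 → t = Nat.log 2 Q + 1 → θ = (n - t) / 2 ^ t + k / 4 + 1 → 2048 ≤ n → 3200 * (L + 1) ^ 2 + 20 ≤ k → 6 * k ≤ n → k ^ 2 ≤ 4 * n → (n : ℝ) ^ (1 - 2 * δ) ≤ (k : ℝ) ^ 2 → 18 + 2 * Real.logb 2 ((L : ℝ) + 1) ≤ ε * Real.logb 2 n → (t ≤ k ∧ k ≤ n ∧ t ≤ n) ∧ (0 < ((n - t : ℕ) : ℝ) * (2 : ℝ)⁻¹ ^ t ∧ ((n - t : ℕ) : ℝ) * (2 : ℝ)⁻¹ ^ t ≤ θ ∧ (θ : ℝ) ≤ 3 * (((n - t : ℕ) : ℝ) * (2 : ℝ)⁻¹ ^ t) ∧ (n.choose t : ℝ) * Real.exp (-(((θ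 : ℝ) / (((n - t : ℕ) : ℝ) * (2 : ℝ)⁻¹ ^ t) - 1) ^ 2 * (((n - t : ℕ) : ℝ) * (2 : ℝ)⁻¹ ^ t)) / 4) ≤ Real.exp (-((L : ℝ) + 1))) ∧ (0 < ((n - k : ℕ) : ℝ) * (2 : ℝ)⁻¹ ^ t ∧ -(((n - k : ℕ) : ℝ) * (2 : ℝ)⁻¹ ^ t) ≤ (θ : ℝ) - ((k - t : ℕ) : ℝ) - 1 ∧ (θ : ℝ) - ((k - t : ℕ) : ℝ) - 1 ≤ ((n - k : ℕ) : ℝ) * (2 : ℝ)⁻¹ ^ t ∧ Real.exp (-((1 - ((θ : ℝ) - ((k - t : ℕ) : ℝ) - 1) / (((n - k : ℕ) : ℝ) * (2 : ℝ)⁻¹ ^ t)) ^ 2 * (((n - k : ℕ) : ℝ) * (2 : ℝ)⁻¹ ^ t)) / 4) ≤ Real.exp (-((L : ℝ) + 1))) ∧ (((n.choose t * (n * (t + 1) + 60 * (n + 3) ^ 4 + 1) : ℕ) : ℝ) ≤ (n : ℝ) ^ ((2 * δ + ε) * Real.logb 2 n)) :=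
  fun hL hQ ht hθ hn hkBig h6k hk2 hkSq hslack => room_derived hL hQ ht hθ hn hkBig h6k hk2 hkSq hslack

end Summit.PneNP.PneNP.Theorems.MonotoneSuffices.Room
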